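/-
Copyright: harness cell b2b-lgcu-borel (gen 27).  Honest framing: the VALUE here is a THEOREM (a law
obeyed by every hypothetical witness of the crux) — NOT summit progress; the crux item
`SubgroupIdentityDesigns` (stmt-MatrixMultiplication-14079) stays open and untouched.
-/
import Mathlib
import Literature.Barriers.MatrixMultiplication.NormalizerBarrier
import Summits.MatrixMultiplication.MatrixMultiplication.Theorems.LieRankDesigns.Negative.Basics

/-!
# The PAIR TWIST LAW: two linear characters force an admissible Fourier mode

Route `LevelGradedCohnUmans`, crux `SubgroupIdentityDesigns`, negative side; ALL primes `p`, all
dimensions `m`, all levels `k`, no hypothesis on the design beyond the crux's own clauses.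

Let `(H₁, H₂, H₃)` be a subgroup-TPP triple of `GL_m(𝔽_p)` carrying a level-`k` identity design
`f(g) = Σ_M c_M ψ(tr(M g))` (`c_M = 0` for `rank M > k`, `f 1 = 1`, `f(a b g) = 0` for `a b g ≠ 1`).
Fix one of the three PAIRS `(A, C) ∈ {(H₁,H₃), (H₁,H₂), (H₂,H₃)}` and two LINEAR CHARACTERS
`σ : A →* ℂ`, `τ : C →* ℂ`.  Call a matrix `M` *`(σ,τ)`-admissible* if
`σ s · τ t = 1` whenever `s ∈ A`, `t ∈ C` and `t M s = M`.

* `pair_law` / `crux_pair_law₁₃`, `₁₂`, `₂₃` : **some matrix of rank `≤ k` is `(σ,τ)`-admissible.**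
  Proof (five lines on paper): the twisted double sum `Σ_{a ∈ A, c ∈ C} σ(a) τ(c) f(a c)` equals `1`
  (only `a = c = 1` has `a c = 1`, by the TPP; `twistedSum_one`), and equals `Σ_M c_M · I(M)` with
  `I(M) = Σ_{a,c} σ(a) τ(c) ψ(tr(M a c))`; reindexing `a ↦ s a`, `c ↦ c t` and `tr(M s X t) = tr(t M s X)`
  give `I(M) = σ(s) τ(t) I(M)` whenever `t M s = M`, so `I(M) = 0` for every NON-admissible `M`
  (`mode_twist_eq_zero`).  If no `M` of rank `≤ k` were admissible the sum would vanish: `0 = 1`.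
* `no_design_of_twist₁₃` : the contrapositive used by the level-one sieve — if for some `(σ, τ)` EVERY
  matrix of rank `≤ k` has a fixing pair `(s, t)` (`t M s = M`) with `σ s τ t ≠ 1`, then `(H₁, H₂, H₃)`
  carries no level-`k` identity design.  (`M = 0` is admissible iff `σ = 1` and `τ = 1`; at level one the
  other modes are `M = v φ`, fixed by `(s, t)` iff `t v = λ v` and `φ s = λ⁻¹ φ`.)  The SCALAR LAW's
  `-1`-case is the instance `s = 1`, `t = -1 ∈ C` central.  At `(m, p) = (3, 11)` this law, evaluated on
  the census classes, excludes every end pair `(H₁, H₃)` left by the one-sided laws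
  (`run/shared/lean/b2b/levelgraded-cu/ORACLE-g27.md` §G27-3/4: data verdict, NOT a theorem of this file).

Sorry-free; standard axioms; no new definitions.
-/

set_option linter.dupNamespace false

noncomputable section

open scoped BigOperators Classical Matrix

namespace Summit.MatrixMultiplication.MatrixMultiplication.Theorems.SubgroupIdentityDesigns.Negative
namespace PairTwistLaw

open Summit.MatrixMultiplication.MatrixMultiplication.Theorems.LieRankDesigns.Negative (GLm Mat)
open Literature.Barriers.MatrixMultiplication (SubgroupTPP)

variable {p m k : ℕ} [hp : Fact p.Prime]

section Pair

variable {A C : Subgroup (GLm p m)}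

/-- **The twisted pair sum of an identity test is `1`.**  If `a c = 1` only for `a = c = 1`
(`a ∈ A`, `c ∈ C`) and `F (a c) = 0` for `a c ≠ 1`, `F 1 = 1`, then
`Σ_{a ∈ A} Σ_{c ∈ C} σ(a) τ(c) F(a c) = 1` for all linear characters `σ, τ`. -/
theorem twistedSum_one (hAC : ∀ a ∈ A, ∀ c ∈ C, a * c = 1 → a = 1 ∧ c = 1)
    (F : GLm p m → ℂ) (hF1 : F 1 = 1) (hF0 : ∀ a ∈ A, ∀ c ∈ C, a * c ≠ 1 → F (a * c) = 0)
    (σ : A →* ℂ) (τ : C →* ℂ) :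
    (∑ a : A, ∑ c : C, σ a * τ c * F ((a : GLm p m) * c)) = 1 := by
  rw [Finset.sum_eq_single (1 : A)]
  · rw [Finset.sum_eq_single (1 : C)]
    · simp [hF1]
    · intro c _ hc
      have hne : ((1 : A) : GLm p m) * (c : GLm p m) ≠ 1 := by
        intro h
        have := (hAC _ (1 : A).2 _ c.2 h).2
        exact hc (Subtype.ext this)
      rw [hF0 _ (1 : A).2 _ c.2 hne, mul_zero]
    · simp
  · intro a _ ha
    refine Finset.sum_eq_zero fun c _ => ?_
    have hne : (a : GLm p m) * (c : GLm p m) ≠ 1 := by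
      intro h
      have := (hAC _ a.2 _ c.2 h).1
      exact ha (Subtype.ext this)
    rw [hF0 _ a.2 _ c.2 hne, mul_zero]
  · simp

/-- **A non-admissible Fourier mode has vanishing twisted sum.**  If `t M s = M` for some `s ∈ A`,
`t ∈ C` with `σ s · τ t ≠ 1`, then `Σ_{a ∈ A} Σ_{c ∈ C} σ(a) τ(c) ψ(tr(M · a c)) = 0`
(reindex `a ↦ s a`, `c ↦ c t`; `tr(M s a c t) = tr(t M s · a c) = tr(M · a c)`). -/
theorem mode_twist_eq_zero (σ : A →* ℂ) (τ : C →* ℂ) (M : Mat p m) {s : A} {t : C}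
    (hfix : ((t : GLm p m) : Mat p m) * M * ((s : GLm p m) : Mat p m) = M) (hne : σ s * τ t ≠ 1) :
    (∑ a : A, ∑ c : C, σ a * τ c *
        ZMod.stdAddChar (Matrix.trace (M * (((a : GLm p m) * c : GLm p m) : Mat p m)))) = 0 := by
  set I := ∑ a : A, ∑ c : C, σ a * τ c *
      ZMod.stdAddChar (Matrix.trace (M * (((a : GLm p m) * c : GLm p m) : Mat p m))) with hI
  have htr : ∀ (a : A) (c : C),
      Matrix.trace (M * ((((s * a : A) : GLm p m) * ((c * t : C) : GLm p m) : GLm p m) : Mat p m)) =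
        Matrix.trace (M * (((a : GLm p m) * c : GLm p m) : Mat p m)) := by
    intro a c
    have e1 : ((((s * a : A) : GLm p m) * ((c * t : C) : GLm p m) : GLm p m) : Mat p m) =
        ((s : GLm p m) : Mat p m) * ((a : GLm p m) : Mat p m) *
          (((c : GLm p m) : Mat p m) * ((t : GLm p m) : Mat p m)) := by
      simp only [Subgroup.coe_mul, Matrix.GeneralLinearGroup.coe_mul]
    have e2 : (((a : GLm p m) * c : GLm p m) : Mat p m) =
        ((a : GLm p m) : Mat p m) * ((c : GLm p m) : Mat p m) := by
      simp only [Matrix.GeneralLinearGroup.coe_mul]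
    rw [e1, e2]
    rw [show M * (((s : GLm p m) : Mat p m) * ((a : GLm p m) : Mat p m) *
          (((c : GLm p m) : Mat p m) * ((t : GLm p m) : Mat p m))) =
        (M * ((s : GLm p m) : Mat p m) * (((a : GLm p m) : Mat p m) * ((c : GLm p m) : Mat p m))) *
          ((t : GLm p m) : Mat p m) by simp only [Matrix.mul_assoc],
      Matrix.trace_mul_comm,
      show ((t : GLm p m) : Mat p m) *
          (M * ((s : GLm p m) : Mat p m) * (((a : GLm p m) : Mat p m) * ((c : GLm p m) : Mat p m))) =
        (((t : GLm p m) : Mat p m) * M * ((s : GLm p m) : Mat p m)) *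
          (((a : GLm p m) : Mat p m) * ((c : GLm p m) : Mat p m)) by simp only [Matrix.mul_assoc],
      hfix]
  have step : (∑ a : A, ∑ c : C, σ (s * a) * τ (c * t) *
      ZMod.stdAddChar (Matrix.trace
        (M * ((((s * a : A) : GLm p m) * ((c * t : C) : GLm p m) : GLm p m) : Mat p m)))) = I := by
    rw [hI]
    refine Fintype.sum_equiv (Equiv.mulLeft s) _ _ fun a => ?_
    refine Fintype.sum_equiv (Equiv.mulRight t) _ _ fun c => ?_
    rfl
  have key : I = σ s * τ t * I := by
    calc I = ∑ a : A, ∑ c : C, σ (s * a) * τ (c * t) *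
          ZMod.stdAddChar (Matrix.trace
            (M * ((((s * a : A) : GLm p m) * ((c * t : C) : GLm p m) : GLm p m) : Mat p m))) :=
          step.symm
      _ = ∑ a : A, ∑ c : C, σ s * τ t * (σ a * τ c *
          ZMod.stdAddChar (Matrix.trace (M * (((a : GLm p m) * c : GLm p m) : Mat p m)))) := by
          refine Finset.sum_congr rfl fun a _ => Finset.sum_congr rfl fun c _ => ?_
          rw [htr a c, map_mul, map_mul]
          ring
      _ = σ s * τ t * I := by
          rw [hI, Finset.mul_sum]
          refine Finset.sum_congr rfl fun a _ => ?_
          rw [Finset.mul_sum]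
  have h2 : (1 - σ s * τ t) * I = 0 := by linear_combination key
  rcases mul_eq_zero.mp h2 with h | h
  · exact absurd (sub_eq_zero.mp h).symm hne
  · exact h

/-- **THE PAIR TWIST LAW (abstract pair form).**  For a pair of subgroups `(A, C)` meeting the
identity-product condition (`a c = 1 ⇒ a = c = 1`), a level-`k` coefficient table whose Fourier
function is `1` at `1` and `0` on `A C ∖ {1}`, and linear characters `σ, τ`: some matrix of rank `≤ k`
is `(σ, τ)`-admissible. -/
theorem pair_law (hAC : ∀ a ∈ A, ∀ c ∈ C, a * c = 1 → a = 1 ∧ c = 1) {c : Mat p m → ℂ}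
    (hsupp : ∀ M, k < M.rank → c M = 0)
    (h1 : (∑ M, c M * ZMod.stdAddChar (Matrix.trace (M * ((1 : GLm p m) : Mat p m)))) = 1)
    (h0 : ∀ a ∈ A, ∀ g ∈ C, a * g ≠ 1 →
      (∑ M, c M * ZMod.stdAddChar (Matrix.trace (M * ((a * g : GLm p m) : Mat p m)))) = 0)
    (σ : A →* ℂ) (τ : C →* ℂ) :
    ∃ M : Mat p m, M.rank ≤ k ∧ ∀ s : A, ∀ t : C,
      ((t : GLm p m) : Mat p m) * M * ((s : GLm p m) : Mat p m) = M → σ s * τ t = 1 := by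
  by_contra hcon
  push Not at hcon
  have hone : (∑ a : A, ∑ g : C, σ a * τ g *
      ∑ M : Mat p m, c M * ZMod.stdAddChar
        (Matrix.trace (M * (((a : GLm p m) * g : GLm p m) : Mat p m)))) = 1 :=
    twistedSum_one hAC
      (fun g : GLm p m => ∑ M : Mat p m, c M * ZMod.stdAddChar (Matrix.trace (M * (g : Mat p m))))
      h1 h0 σ τ
  have hswap : (∑ a : A, ∑ g : C, σ a * τ g *
      ∑ M : Mat p m, c M * ZMod.stdAddChar
        (Matrix.trace (M * (((a : GLm p m) * g : GLm p m) : Mat p m)))) =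
      ∑ M : Mat p m, c M * ∑ a : A, ∑ g : C, σ a * τ g *
        ZMod.stdAddChar (Matrix.trace (M * (((a : GLm p m) * g : GLm p m) : Mat p m))) := by
    simp only [Finset.mul_sum]
    calc ∑ a : A, ∑ g : C, ∑ M : Mat p m, σ a * τ g * (c M *
            ZMod.stdAddChar (Matrix.trace (M * (((a : GLm p m) * g : GLm p m) : Mat p m))))
        = ∑ a : A, ∑ M : Mat p m, ∑ g : C, σ a * τ g * (c M *
            ZMod.stdAddChar (Matrix.trace (M * (((a : GLm p m) * g : GLm p m) : Mat p m)))) :=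
          Finset.sum_congr rfl fun a _ => Finset.sum_comm
      _ = ∑ M : Mat p m, ∑ a : A, ∑ g : C, σ a * τ g * (c M *
            ZMod.stdAddChar (Matrix.trace (M * (((a : GLm p m) * g : GLm p m) : Mat p m)))) :=
          Finset.sum_comm
      _ = ∑ M : Mat p m, ∑ a : A, ∑ g : C, c M * (σ a * τ g *
            ZMod.stdAddChar (Matrix.trace (M * (((a : GLm p m) * g : GLm p m) : Mat p m)))) := by
          refine Finset.sum_congr rfl fun M _ => Finset.sum_congr rfl fun a _ =>
            Finset.sum_congr rfl fun g _ => ?_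
          ring
  have hzero : (∑ M : Mat p m, c M * ∑ a : A, ∑ g : C, σ a * τ g *
      ZMod.stdAddChar (Matrix.trace (M * (((a : GLm p m) * g : GLm p m) : Mat p m)))) = 0 := by
    refine Finset.sum_eq_zero fun M _ => ?_
    by_cases hM : k < M.rank
    · rw [hsupp M hM, zero_mul]
    · obtain ⟨s, t, hfix, hne⟩ := hcon M (not_lt.mp hM)
      rw [mode_twist_eq_zero σ τ M hfix hne, mul_zero]
  rw [hswap, hzero] at hone
  exact zero_ne_one hone

end Pair

section Crux

variable {H₁ H₂ H₃ : Subgroup (GLm p m)}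

/-- **PAIR TWIST LAW for a witness, pair `(H₁, H₃)`.**  For every subgroup-TPP triple with a
level-`k` identity design and all linear characters `σ` of `H₁`, `τ` of `H₃`, some matrix `M` of rank
`≤ k` satisfies `σ s · τ t = 1` whenever `s ∈ H₁`, `t ∈ H₃`, `t M s = M`. -/
theorem crux_pair_law₁₃ (htpp : SubgroupTPP H₁ H₂ H₃)
    (hdes : ∃ c : Mat p m → ℂ, (∀ M, k < M.rank → c M = 0) ∧
      (∑ M, c M * ZMod.stdAddChar (Matrix.trace (M * ((1 : GLm p m) : Mat p m)))) = 1 ∧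
      ∀ a ∈ H₁, ∀ b ∈ H₂, ∀ g ∈ H₃, a * b * g ≠ 1 →
        (∑ M, c M * ZMod.stdAddChar (Matrix.trace (M * ((a * b * g : GLm p m) : Mat p m)))) = 0)
    (σ : H₁ →* ℂ) (τ : H₃ →* ℂ) :
    ∃ M : Mat p m, M.rank ≤ k ∧ ∀ s : H₁, ∀ t : H₃,
      ((t : GLm p m) : Mat p m) * M * ((s : GLm p m) : Mat p m) = M → σ s * τ t = 1 := by
  obtain ⟨c, hsupp, h1, h0⟩ := hdes
  refine pair_law (A := H₁) (C := H₃) (fun a ha g hg h => ?_) hsupp h1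
    (fun a ha g hg hne => ?_) σ τ
  · have h' := htpp a ha 1 H₂.one_mem g hg (by simpa using h)
    exact ⟨h'.1, h'.2.2⟩
  · have h' := h0 a ha 1 H₂.one_mem g hg (by simpa using hne)
    simpa using h'

/-- **PAIR TWIST LAW for a witness, pair `(H₁, H₂)`** (`s ∈ H₁` on the right, `t ∈ H₂` on the left). -/
theorem crux_pair_law₁₂ (htpp : SubgroupTPP H₁ H₂ H₃)
    (hdes : ∃ c : Mat p m → ℂ, (∀ M, k < M.rank → c M = 0) ∧
      (∑ M, c M * ZMod.stdAddChar (Matrix.trace (M * ((1 : GLm p m) : Mat p m)))) = 1 ∧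
      ∀ a ∈ H₁, ∀ b ∈ H₂, ∀ g ∈ H₃, a * b * g ≠ 1 →
        (∑ M, c M * ZMod.stdAddChar (Matrix.trace (M * ((a * b * g : GLm p m) : Mat p m)))) = 0)
    (σ : H₁ →* ℂ) (τ : H₂ →* ℂ) :
    ∃ M : Mat p m, M.rank ≤ k ∧ ∀ s : H₁, ∀ t : H₂,
      ((t : GLm p m) : Mat p m) * M * ((s : GLm p m) : Mat p m) = M → σ s * τ t = 1 := by
  obtain ⟨c, hsupp, h1, h0⟩ := hdes
  refine pair_law (A := H₁) (C := H₂) (fun a ha b hb h => ?_) hsupp h1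
    (fun a ha b hb hne => ?_) σ τ
  · have h' := htpp a ha b hb 1 H₃.one_mem (by simpa using h)
    exact ⟨h'.1, h'.2.1⟩
  · have h' := h0 a ha b hb 1 H₃.one_mem (by simpa using hne)
    simpa using h'

/-- **PAIR TWIST LAW for a witness, pair `(H₂, H₃)`** (`s ∈ H₂` on the right, `t ∈ H₃` on the left). -/
theorem crux_pair_law₂₃ (htpp : SubgroupTPP H₁ H₂ H₃)
    (hdes : ∃ c : Mat p m → ℂ, (∀ M, k < M.rank → c M = 0) ∧
      (∑ M, c M * ZMod.stdAddChar (Matrix.trace (M * ((1 : GLm p m) : Mat p m)))) = 1 ∧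
      ∀ a ∈ H₁, ∀ b ∈ H₂, ∀ g ∈ H₃, a * b * g ≠ 1 →
        (∑ M, c M * ZMod.stdAddChar (Matrix.trace (M * ((a * b * g : GLm p m) : Mat p m)))) = 0)
    (σ : H₂ →* ℂ) (τ : H₃ →* ℂ) :
    ∃ M : Mat p m, M.rank ≤ k ∧ ∀ s : H₂, ∀ t : H₃,
      ((t : GLm p m) : Mat p m) * M * ((s : GLm p m) : Mat p m) = M → σ s * τ t = 1 := by
  obtain ⟨c, hsupp, h1, h0⟩ := hdes
  refine pair_law (A := H₂) (C := H₃) (fun b hb g hg h => ?_) hsupp h1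
    (fun b hb g hg hne => ?_) σ τ
  · have h' := htpp 1 H₁.one_mem b hb g hg (by simpa using h)
    exact ⟨h'.2.1, h'.2.2⟩
  · have h' := h0 1 H₁.one_mem b hb g hg (by simpa using hne)
    simpa using h'

/-- **The END-PAIR test of the sieve (contrapositive of `crux_pair_law₁₃`).**  If for some linear
characters `σ` of `H₁` and `τ` of `H₃` EVERY matrix of rank `≤ k` is moved-or-twisted — it has a fixing
pair `t M s = M` (`s ∈ H₁`, `t ∈ H₃`) with `σ s · τ t ≠ 1` — then the subgroup-TPP triple
`(H₁, H₂, H₃)` carries no level-`k` identity design. -/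
theorem no_design_of_twist₁₃ (htpp : SubgroupTPP H₁ H₂ H₃) (σ : H₁ →* ℂ) (τ : H₃ →* ℂ)
    (hkill : ∀ M : Mat p m, M.rank ≤ k → ∃ s : H₁, ∃ t : H₃,
      ((t : GLm p m) : Mat p m) * M * ((s : GLm p m) : Mat p m) = M ∧ σ s * τ t ≠ 1) :
    ¬ ∃ c : Mat p m → ℂ, (∀ M, k < M.rank → c M = 0) ∧
      (∑ M, c M * ZMod.stdAddChar (Matrix.trace (M * ((1 : GLm p m) : Mat p m)))) = 1 ∧
      ∀ a ∈ H₁, ∀ b ∈ H₂, ∀ g ∈ H₃, a * b * g ≠ 1 →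
        (∑ M, c M * ZMod.stdAddChar (Matrix.trace (M * ((a * b * g : GLm p m) : Mat p m)))) = 0 := by
  intro hdes
  obtain ⟨M, hM, hadm⟩ := crux_pair_law₁₃ (k := k) htpp hdes σ τ
  obtain ⟨s, t, hfix, hne⟩ := hkill M hM
  exact hne (hadm s t hfix)

end Crux

end PairTwistLaw
end Summit.MatrixMultiplication.MatrixMultiplication.Theorems.SubgroupIdentityDesigns.Negative
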